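import Literature.RepresentationTheory.HeisenbergGroup.WeylSystemGluing
import Literature.RepresentationTheory.HeisenbergGroup.WeylSystemCommutingAction
import Literature.RepresentationTheory.HeisenbergGroup.StoneVonNeumannLatticePairSchur
import HarnessLib

/-!
# Uniqueness of the irreducible representation of a Weyl system commuting with a lattice-pair Heisenberg group:
# the abstract form of the GLOBAL uniqueness of `ρ_ψ` (archimedean part ⊗ finite-adelic part)

Topic `RepresentationTheory/HeisenbergGroup`; namespace `Literature.RepresentationTheory.HeisenbergGroup`.  KERNEL ONLY:
theorems; no definition, no named fact, no record, no `sorry`.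

[GelbartRogawski1991, §3.1 p. 454 L19–21]: "let `ρ_ψ` be an irreducible unitary representation of `H_𝐀(W)` with central
character `ψ` (`ρ_ψ` is unique up to isomorphism)".  The adelic Heisenberg group is the product, amalgamated over the
centre, of its archimedean part `H(W_∞)` — a real Heisenberg group, whose unitary `ψ_∞`-representations are Weyl systems
(`HeisenbergRealUniquenessCoords.lean`, `HeisenbergCentralCharacterReduction.lean`) — and its finite-adelic part
`H(W_fin)`, a polarised Heisenberg group over `𝐀_fin` carrying a dual lattice pair (`∏_v 𝒪_vⁿ` and its dual, scalings
by non-zero integers; [Weil1964, Chap. III n° 37–39]).  This file proves the uniqueness theorem for that SHAPE, with no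
adelic object in it: a complex Hilbert space `E` carrying

* a Weyl system `W` over a finite-dimensional real inner product space `(V, J)` (`IsWeylSystem J W`,
  `WeylSystemVacuumProjection.lean`), and
* a commuting representation `τ` of a polarised Heisenberg group `H = Heisenberg (polar β)`, `β : X →ₗ[R] Y →ₗ[R] R`, by
  linear isometries, with continuous orbit maps `w ↦ τ(w, 0) v` on `X × Y` and central character `ψ`, where `ψ(β x y)`
  admits a dual lattice pair `(B₁, B₂)` whose unit scalings shrink to `0` (`IsDualLatticePair`, `DualLatticePair.lean`),

JOINTLY IRREDUCIBLE (no closed subspace other than `⊥`, `⊤` is invariant under all `W x` and all `τ h`).  THEOREM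
(**`IsWeylSystem.exists_linearIsometryEquiv_of_irreducible_commuting_latticePair`**): any two such `(E₁, W₁, τ₁)`,
`(E₂, W₂, τ₂)` with `E₁, E₂ ≠ 0` are unitarily equivalent — `U : E₁ ≃ₗᵢ[ℂ] E₂` with `U ∘ W₁ x = W₂ x ∘ U` and
`U ∘ τ₁ h = τ₂ h ∘ U`.  Proof = von Neumann's reduction to the VACUUM SUBSPACE `M = P E` of the Weyl system
([vonNeumann1931, §5]): `τ` preserves `M` and `M` is irreducible under `τ` (`WeylSystemCommutingAction.lean`,
`vacuum_trivial_of_irreducible`); `M ≠ 0` (`exists_vacuumVec_ne_zero`); the lattice-pair uniqueness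
(`StoneVonNeumannLatticePair.lean`) gives a unitary `τ`-intertwiner `T : M₁ ≃ M₂`; and a vacuum intertwiner extends to
a unitary intertwining both structures (`WeylSystemGluing.lean`).

* §1 the `τ`-representation on the vacuum subspace (`exists_rep_vacuumSubspace`, built with `LinearMap.restrict`; a
  `Prop`, no definition) and the transfer of joint irreducibility to it (`restrictVacuum_irreducible`);
* §2 the theorem;
* §3 **Schur for the pair `(W, τ)`** (`exists_commutant_eq_smul_of_commuting_latticePair`): a bounded operator commuting
  with all `W x` and all `τ h` is a scalar (it preserves the vacuum subspace, where `StoneVonNeumannLatticePairSchur.lean`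
  applies, and the `W x m`, `m ∈ M`, are total); hence the unitary `U` of §2 is unique up to a scalar of modulus one
  (`linearIsometryEquiv_unique_of_commuting_latticePair`) — the kernel `ℂˣ` of `(g, M_g) ↦ g` for the adelic group of
  pairs ([GelbartRogawski1991, §3.1 p. 454 L25–27] "`0 ⟶ ℂ* ⟶ Mp_𝐀(W) ⟶ Sp_𝐀(W) ⟶ 0`").

What then remains for the adelic `ρ_ψ` itself is bookkeeping (the decomposition `H_𝐀(W) ⊇ H(W_∞) · H(W_fin)`, the Weyl
form of the archimedean part, the adelic dual lattice pair) and the number-theoretic input that a non-trivial character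
of `𝐀/F` is non-trivial at every place.  Nothing of the cited sources is asserted.

## References
* [vonNeumann1931] J. von Neumann, *Die Eindeutigkeit der Schrödingerschen Operatoren*, Math. Ann. 104 (1931) 570–578, §5.
* [Weil1964] A. Weil, Acta Math. 111 (1964), Chap. I n° 11, Chap. III n° 37–39.
* [MoeglinVignerasWaldspurger1987] C. Mœglin, M.-F. Vignéras, J.-L. Waldspurger, LNM 1291 (1987), Chap. 2 I.2, I.8.
* [GelbartRogawski1991] S. Gelbart, J. Rogawski, Invent. Math. 105 (1991), §3.1 p. 454 L19–21.
-/

set_option autoImplicit false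

noncomputable section

open MeasureTheory Complex Filter
open scoped InnerProductSpace ComplexConjugate Topology Pointwise

namespace Literature.RepresentationTheory.HeisenbergGroup

open Literature.RepresentationTheory.Unitary

variable {V : Type*} [NormedAddCommGroup V] [InnerProductSpace ℝ V] [FiniteDimensional ℝ V]
  [MeasurableSpace V] [BorelSpace V]
variable {E : Type*} [NormedAddCommGroup E] [InnerProductSpace ℂ E] [CompleteSpace E]
variable {E₁ : Type*} [NormedAddCommGroup E₁] [InnerProductSpace ℂ E₁] [CompleteSpace E₁]
variable {E₂ : Type*} [NormedAddCommGroup E₂] [InnerProductSpace ℂ E₂] [CompleteSpace E₂]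

namespace IsWeylSystem

variable {J : V →ₗ[ℝ] V} {W : V → E →L[ℂ] E} {W₁ : V → E₁ →L[ℂ] E₁} {W₂ : V → E₂ →L[ℂ] E₂}

/-! ## §1 The representation of a commuting action on the vacuum subspace -/

section Restrict

variable {G : Type*} [Group G]

/-- **the commuting action restricted to the vacuum subspace**: for an isometric action `τ` commuting with the Weyl
system, `M₀ = P E` is `τ`-stable (`rep_mem_vacuumSubspace`) and `τ` restricts to a representation `σ` of `G` on `M₀`
with `σ(g) m = τ(g) m`. [cite: vonNeumann1931, §5] -/
theorem exists_rep_vacuumSubspace (hW : IsWeylSystem J W) (τ : Representation ℂ G E)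
    (hτu : ∀ (g : G) (v : E), ‖τ g v‖ = ‖v‖) (hτW : ∀ (g : G) (x : V) (v : E), τ g (W x v) = W x (τ g v)) :
    ∃ σ : Representation ℂ G hW.vacuumSubspace,
      ∀ (g : G) (m : hW.vacuumSubspace), ((σ g m : hW.vacuumSubspace) : E) = τ g m := by
  have hinv : ∀ g : G, ∀ m ∈ hW.vacuumSubspace, τ g m ∈ hW.vacuumSubspace :=
    fun g m hm => hW.rep_mem_vacuumSubspace τ hτu hτW g hm
  let σ : Representation ℂ G hW.vacuumSubspace :=
    { toFun := fun g => (τ g).restrict (hinv g)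
      map_one' := by
        apply LinearMap.ext
        intro x
        apply Subtype.ext
        simp only [LinearMap.coe_restrict_apply, map_one, Module.End.one_apply]
      map_mul' := fun g g' => by
        apply LinearMap.ext
        intro x
        apply Subtype.ext
        simp only [LinearMap.coe_restrict_apply, map_mul, Module.End.mul_apply] }
  exact ⟨σ, fun g m => rfl⟩

/-- **joint irreducibility lives on the vacuum subspace**: if `E` has no closed subspace other than `⊥`, `⊤` invariant
under all `W x` and all `τ g`, then the restricted representation `σ` on `M₀` has no closed invariant subspace other
than `⊥`, `⊤` (`vacuum_trivial_of_irreducible`, moved along the closed embedding `M₀ ⊆ E`). [cite: vonNeumann1931, §5] -/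
theorem restrictVacuum_irreducible (hW : IsWeylSystem J W) (τ : Representation ℂ G E)
    (hτu : ∀ (g : G) (v : E), ‖τ g v‖ = ‖v‖) (hτW : ∀ (g : G) (x : V) (v : E), τ g (W x v) = W x (τ g v))
    (hirr : ∀ K : Submodule ℂ E, IsClosed (K : Set E) → (∀ (x : V), ∀ v ∈ K, W x v ∈ K) →
      (∀ (g : G), ∀ v ∈ K, τ g v ∈ K) → K = ⊥ ∨ K = ⊤)
    (σ : Representation ℂ G hW.vacuumSubspace)
    (hσ : ∀ (g : G) (m : hW.vacuumSubspace), ((σ g m : hW.vacuumSubspace) : E) = τ g m)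
    (K : Submodule ℂ hW.vacuumSubspace) (hKc : IsClosed (K : Set hW.vacuumSubspace))
    (hKσ : ∀ (g : G), ∀ v ∈ K, σ g v ∈ K) : K = ⊥ ∨ K = ⊤ := by
  set K' : Submodule ℂ E := K.map hW.vacuumSubspace.subtype with hK'
  have hK'c : IsClosed (K' : Set E) := by
    have e : (K' : Set E) = Subtype.val '' (K : Set hW.vacuumSubspace) := by
      rw [hK', Submodule.map_coe, Submodule.coe_subtype]
    rw [e]
    exact hW.isClosed_vacuumSubspace.isClosedEmbedding_subtypeVal.isClosedMap _ hKc
  have hK'le : K' ≤ hW.vacuumSubspace := Submodule.map_subtype_le _ _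
  have hK'τ : ∀ (g : G), ∀ v ∈ K', τ g v ∈ K' := by
    rintro g v ⟨k, hk, rfl⟩
    exact ⟨σ g k, hKσ g k hk, hσ g k⟩
  have hinj : Function.Injective (Submodule.map hW.vacuumSubspace.subtype : Submodule ℂ hW.vacuumSubspace → _) :=
    Submodule.map_injective_of_injective hW.vacuumSubspace.injective_subtype
  rcases hW.vacuum_trivial_of_irreducible τ hτu hτW hirr K' hK'c hK'le hK'τ with h | h
  · left
    exact hinj (h.trans (Submodule.map_bot _).symm)
  · right
    exact hinj (h.trans (Submodule.map_subtype_top _).symm)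

/-- the vacuum subspace of a Weyl system on `E ≠ 0` is `≠ 0` (`P ≠ 0`, Fourier inversion). [cite: vonNeumann1931, §5] -/
theorem nontrivial_vacuumSubspace [Nontrivial E] (hW : IsWeylSystem J W) :
    Nontrivial hW.vacuumSubspace := by
  obtain ⟨u, hu⟩ := hW.exists_vacuumVec_ne_zero
  exact ⟨⟨⟨_, hW.vacuumVec_mem_vacuumSubspace u⟩, 0, fun h => hu (congrArg Subtype.val h)⟩⟩

end Restrict

/-! ## §2 Uniqueness for a Weyl system commuting with a lattice-pair Heisenberg group -/

section Uniqueness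

variable {R : Type*} [CommRing R] {X Y : Type*} [AddCommGroup X] [Module R X] [AddCommGroup Y] [Module R Y]
  [TopologicalSpace X] [IsTopologicalAddGroup X] [ContinuousConstSMul R X]
  [TopologicalSpace Y] [IsTopologicalAddGroup Y] [ContinuousConstSMul R Y]
  (β : X →ₗ[R] Y →ₗ[R] R) (ψ : AddChar R Circle) {B₁ : AddSubgroup X} {B₂ : AddSubgroup Y}

/-- **Uniqueness of the joint irreducible representation of a Weyl system and a commuting lattice-pair Heisenberg group**
(the shape of the adelic `ρ_ψ`: archimedean Weyl system ⊗ finite-adelic Heisenberg group).  `(V, J, Wᵢ)` Weyl systems on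
complex Hilbert spaces `Eᵢ ≠ 0`; `τᵢ` representations of `H = Heisenberg (polar β)` on `Eᵢ` by linear isometries
commuting with `Wᵢ`, with continuous orbit maps `w ↦ τᵢ(w, 0) v` and central character `ψ`; `(B₁, B₂)` a dual lattice
pair for `ψ(β x y)` whose unit scalings shrink to `0`; and `Eᵢ` jointly irreducible under `(Wᵢ, τᵢ)`.  Then there is a
unitary `U : E₁ ≃ₗᵢ[ℂ] E₂` with `U (W₁ x v) = W₂ x (U v)` and `U (τ₁ h v) = τ₂ h (U v)` — von Neumann's reduction to
the vacuum subspace, on which the lattice-pair uniqueness (`exists_linearIsometryEquiv_of_irreducible_of_isDualLatticePair`)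
supplies the intertwiner that `exists_linearIsometryEquiv_of_vacuumIntertwiner` extends.
[cite: vonNeumann1931, §5] -/
theorem exists_linearIsometryEquiv_of_irreducible_commuting_latticePair [Nontrivial E₁] [Nontrivial E₂]
    (hW₁ : IsWeylSystem J W₁) (hW₂ : IsWeylSystem J W₂)
    (τ₁ : Representation ℂ (Heisenberg (polar β)) E₁) (τ₂ : Representation ℂ (Heisenberg (polar β)) E₂)
    (h₁u : ∀ (h : Heisenberg (polar β)) (v : E₁), ‖τ₁ h v‖ = ‖v‖)
    (h₂u : ∀ (h : Heisenberg (polar β)) (v : E₂), ‖τ₂ h v‖ = ‖v‖)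
    (h₁W : ∀ (h : Heisenberg (polar β)) (x : V) (v : E₁), τ₁ h (W₁ x v) = W₁ x (τ₁ h v))
    (h₂W : ∀ (h : Heisenberg (polar β)) (x : V) (v : E₂), τ₂ h (W₂ x v) = W₂ x (τ₂ h v))
    (h₁c : ∀ v : E₁, Continuous fun w : X × Y => τ₁ ⟨w, 0⟩ v)
    (h₂c : ∀ v : E₂, Continuous fun w : X × Y => τ₂ ⟨w, 0⟩ v)
    (h₁z : ∀ (t : R) (v : E₁), τ₁ (Heisenberg.ofCenter (polar β) (Multiplicative.ofAdd t)) v = ((ψ t : Circle) : ℂ) • v)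
    (h₂z : ∀ (t : R) (v : E₂), τ₂ (Heisenberg.ofCenter (polar β) (Multiplicative.ofAdd t)) v = ((ψ t : Circle) : ℂ) • v)
    (h₁i : ∀ K : Submodule ℂ E₁, IsClosed (K : Set E₁) → (∀ (x : V), ∀ v ∈ K, W₁ x v ∈ K) →
      (∀ (h : Heisenberg (polar β)), ∀ v ∈ K, τ₁ h v ∈ K) → K = ⊥ ∨ K = ⊤)
    (h₂i : ∀ K : Submodule ℂ E₂, IsClosed (K : Set E₂) → (∀ (x : V), ∀ v ∈ K, W₂ x v ∈ K) →
      (∀ (h : Heisenberg (polar β)), ∀ v ∈ K, τ₂ h v ∈ K) → K = ⊥ ∨ K = ⊤)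
    (hB : IsDualLatticePair β ψ B₁ B₂)
    (hX : ∀ N ∈ 𝓝 (0 : X), ∃ a : Rˣ, (((a : R) • B₁ : AddSubgroup X) : Set X) ⊆ N)
    (hY : ∀ N ∈ 𝓝 (0 : Y), ∃ a : Rˣ, (((a : R) • B₂ : AddSubgroup Y) : Set Y) ⊆ N) :
    ∃ U : E₁ ≃ₗᵢ[ℂ] E₂, (∀ (x : V) (v : E₁), U (W₁ x v) = W₂ x (U v)) ∧
      ∀ (h : Heisenberg (polar β)) (v : E₁), U (τ₁ h v) = τ₂ h (U v) := by
  -- the vacuum subspaces as Hilbert spaces with the restricted actions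
  set M₁ := hW₁.vacuumSubspace with hM₁
  set M₂ := hW₂.vacuumSubspace with hM₂
  haveI : CompleteSpace M₁ := hW₁.isClosed_vacuumSubspace.completeSpace_coe
  haveI : CompleteSpace M₂ := hW₂.isClosed_vacuumSubspace.completeSpace_coe
  haveI : Nontrivial M₁ := hW₁.nontrivial_vacuumSubspace
  haveI : Nontrivial M₂ := hW₂.nontrivial_vacuumSubspace
  obtain ⟨σ₁, hσ₁⟩ := hW₁.exists_rep_vacuumSubspace τ₁ h₁u h₁W
  obtain ⟨σ₂, hσ₂⟩ := hW₂.exists_rep_vacuumSubspace τ₂ h₂u h₂W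
  have hσ₁u : ∀ (h : Heisenberg (polar β)) (m : M₁), ‖σ₁ h m‖ = ‖m‖ := fun h m => by
    change ‖((σ₁ h m : M₁) : E₁)‖ = ‖(m : E₁)‖
    rw [hσ₁, h₁u]
  have hσ₂u : ∀ (h : Heisenberg (polar β)) (m : M₂), ‖σ₂ h m‖ = ‖m‖ := fun h m => by
    change ‖((σ₂ h m : M₂) : E₂)‖ = ‖(m : E₂)‖
    rw [hσ₂, h₂u]
  have hσ₁c : ∀ m : M₁, Continuous fun w : X × Y => σ₁ ⟨w, 0⟩ m := fun m => by
    refine continuous_induced_rng.2 ?_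
    simp only [Function.comp_def, hσ₁]
    exact h₁c m
  have hσ₂c : ∀ m : M₂, Continuous fun w : X × Y => σ₂ ⟨w, 0⟩ m := fun m => by
    refine continuous_induced_rng.2 ?_
    simp only [Function.comp_def, hσ₂]
    exact h₂c m
  have hσ₁z : ∀ (t : R) (m : M₁),
      σ₁ (Heisenberg.ofCenter (polar β) (Multiplicative.ofAdd t)) m = ((ψ t : Circle) : ℂ) • m := fun t m => by
    apply Subtype.ext
    rw [hσ₁, h₁z, Submodule.coe_smul]
  have hσ₂z : ∀ (t : R) (m : M₂),
      σ₂ (Heisenberg.ofCenter (polar β) (Multiplicative.ofAdd t)) m = ((ψ t : Circle) : ℂ) • m := fun t m => by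
    apply Subtype.ext
    rw [hσ₂, h₂z, Submodule.coe_smul]
  have hσ₁i := hW₁.restrictVacuum_irreducible τ₁ h₁u h₁W h₁i σ₁ hσ₁
  have hσ₂i := hW₂.restrictVacuum_irreducible τ₂ h₂u h₂W h₂i σ₂ hσ₂
  -- the lattice-pair uniqueness on the vacuum subspaces
  obtain ⟨T, hT⟩ := exists_linearIsometryEquiv_of_irreducible_of_isDualLatticePair β ψ hB hX hY σ₁ σ₂ hσ₁u hσ₁c
    hσ₁z hσ₁i hσ₂u hσ₂c hσ₂z hσ₂i
  -- the vacuum intertwiner as a bounded operator `E₁ → E₂` (through the orthogonal projection onto `M₁`)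
  set T' : E₁ →L[ℂ] E₂ := M₂.subtypeL ∘L
    ((T.toContinuousLinearEquiv : M₁ →L[ℂ] M₂) ∘L M₁.orthogonalProjectionOnto) with hT'def
  have hT' : ∀ (m : E₁) (hm : m ∈ M₁), T' m = ((T ⟨m, hm⟩ : M₂) : E₂) := by
    intro m hm
    have hP : M₁.orthogonalProjectionOnto m = ⟨m, hm⟩ :=
      Submodule.orthogonalProjectionOnto_mem_subspace_eq_self (⟨m, hm⟩ : M₁)
    simp only [hT'def, ContinuousLinearMap.comp_apply, Submodule.subtypeL_apply, ContinuousLinearEquiv.coe_coe,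
      LinearIsometryEquiv.coe_toContinuousLinearEquiv, hP]
  have hTn : ∀ m ∈ M₁, ‖T' m‖ = ‖m‖ := fun m hm => by
    rw [hT' m hm, Submodule.norm_coe, LinearIsometryEquiv.norm_map]
    rfl
  have hTm : ∀ m ∈ M₁, T' m ∈ M₂ := fun m hm => by
    rw [hT' m hm]
    exact (T ⟨m, hm⟩).2
  have hTs : ∀ m₂ ∈ M₂, ∃ m₁ ∈ M₁, T' m₁ = m₂ := fun m₂ hm₂ => by
    refine ⟨(T.symm ⟨m₂, hm₂⟩ : M₁), (T.symm ⟨m₂, hm₂⟩).2, ?_⟩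
    rw [hT' _ (T.symm ⟨m₂, hm₂⟩).2]
    have e : (⟨((T.symm ⟨m₂, hm₂⟩ : M₁) : E₁), (T.symm ⟨m₂, hm₂⟩).2⟩ : M₁) = T.symm ⟨m₂, hm₂⟩ := rfl
    rw [e, LinearIsometryEquiv.apply_symm_apply]
  have hTτ : ∀ (h : Heisenberg (polar β)), ∀ m ∈ M₁, T' (τ₁ h m) = τ₂ h (T' m) := fun h m hm => by
    have hm' : τ₁ h m ∈ M₁ := hW₁.rep_mem_vacuumSubspace τ₁ h₁u h₁W h hm
    rw [hT' _ hm', hT' m hm]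
    have e : (⟨τ₁ h m, hm'⟩ : M₁) = σ₁ h ⟨m, hm⟩ := Subtype.ext (by rw [hσ₁])
    rw [e, hT, hσ₂]
  obtain ⟨U, -, hUW, hUτ⟩ := hW₁.exists_linearIsometryEquiv_of_vacuumIntertwiner hW₂ τ₁ τ₂ h₁u h₂u h₁W h₂W T' hTn
    hTm hTs hTτ
  exact ⟨U, hUW, hUτ⟩

/-! ## §3 Schur for the pair `(W, τ)` and uniqueness of the intertwiner up to `S¹` -/

/-- **the commutant of a Weyl system together with a commuting irreducible lattice-pair Heisenberg action is scalar**: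
for `(E, W, τ)` as in `exists_linearIsometryEquiv_of_irreducible_commuting_latticePair` (jointly irreducible, `E ≠ 0`),
a bounded `A` with `A ∘ W x = W x ∘ A` and `A ∘ τ h = τ h ∘ A` is `c • 1`: `A` preserves the vacuum subspace `M`
(`mem_vacuumSubspace_of_commute`), acts there by a scalar (`exists_commutant_eq_smul` for the restricted action), and the
vectors `W x m`, `m ∈ M`, are total (`dense_span_apply_vacuumSubspace`). [cite: vonNeumann1931, §5] -/
theorem exists_commutant_eq_smul_of_commuting_latticePair [Nontrivial E] (hW : IsWeylSystem J W)
    (τ : Representation ℂ (Heisenberg (polar β)) E)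
    (hτu : ∀ (h : Heisenberg (polar β)) (v : E), ‖τ h v‖ = ‖v‖)
    (hτW : ∀ (h : Heisenberg (polar β)) (x : V) (v : E), τ h (W x v) = W x (τ h v))
    (hτc : ∀ v : E, Continuous fun w : X × Y => τ ⟨w, 0⟩ v)
    (hτz : ∀ (t : R) (v : E), τ (Heisenberg.ofCenter (polar β) (Multiplicative.ofAdd t)) v = ((ψ t : Circle) : ℂ) • v)
    (hirr : ∀ K : Submodule ℂ E, IsClosed (K : Set E) → (∀ (x : V), ∀ v ∈ K, W x v ∈ K) →
      (∀ (h : Heisenberg (polar β)), ∀ v ∈ K, τ h v ∈ K) → K = ⊥ ∨ K = ⊤)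
    (hB : IsDualLatticePair β ψ B₁ B₂)
    (hX : ∀ N ∈ 𝓝 (0 : X), ∃ a : Rˣ, (((a : R) • B₁ : AddSubgroup X) : Set X) ⊆ N)
    (hY : ∀ N ∈ 𝓝 (0 : Y), ∃ a : Rˣ, (((a : R) • B₂ : AddSubgroup Y) : Set Y) ⊆ N)
    (A : E →L[ℂ] E) (hAW : ∀ (x : V) (v : E), A (W x v) = W x (A v))
    (hAτ : ∀ (h : Heisenberg (polar β)) (v : E), A (τ h v) = τ h (A v)) :
    ∃ c : ℂ, ∀ v : E, A v = c • v := by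
  set M := hW.vacuumSubspace with hM
  haveI : CompleteSpace M := hW.isClosed_vacuumSubspace.completeSpace_coe
  haveI : Nontrivial M := hW.nontrivial_vacuumSubspace
  obtain ⟨σ, hσ⟩ := hW.exists_rep_vacuumSubspace τ hτu hτW
  have hσu : ∀ (h : Heisenberg (polar β)) (m : M), ‖σ h m‖ = ‖m‖ := fun h m => by
    change ‖((σ h m : M) : E)‖ = ‖(m : E)‖
    rw [hσ, hτu]
  have hσc : ∀ m : M, Continuous fun w : X × Y => σ ⟨w, 0⟩ m := fun m => by
    refine continuous_induced_rng.2 ?_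
    simp only [Function.comp_def, hσ]
    exact hτc m
  have hσz : ∀ (t : R) (m : M),
      σ (Heisenberg.ofCenter (polar β) (Multiplicative.ofAdd t)) m = ((ψ t : Circle) : ℂ) • m := fun t m => by
    apply Subtype.ext
    rw [hσ, hτz, Submodule.coe_smul]
  have hσi := hW.restrictVacuum_irreducible τ hτu hτW hirr σ hσ
  -- `A` restricted to `M` commutes with `σ`, hence is a scalar `c` there
  have hAM : ∀ m : M, A (m : E) ∈ M := fun m => hW.mem_vacuumSubspace_of_commute A hAW m.2
  set AM : M →L[ℂ] M := (A.comp M.subtypeL).codRestrict M hAM with hAMdef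
  have hAMv : ∀ m : M, ((AM m : M) : E) = A m := fun m => rfl
  have hAMσ : ∀ (h : Heisenberg (polar β)) (m : M), AM (σ h m) = σ h (AM m) := fun h m => by
    apply Subtype.ext
    rw [hAMv, hσ, hAτ, hσ, hAMv]
  obtain ⟨c, hc⟩ := exists_commutant_eq_smul β ψ hB hX hY σ hσu hσc hσz hσi AM hAMσ
  have hcE : ∀ m ∈ M, A m = c • m := fun m hm => by
    have h := congrArg Subtype.val (hc ⟨m, hm⟩)
    rwa [hAMv, Submodule.coe_smul] at h
  -- `A = c` on the total family `W x m`
  refine ⟨c, fun v => ?_⟩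
  have hAc : A = c • ContinuousLinearMap.id ℂ E := by
    refine ContinuousLinearMap.ext_on hW.dense_span_apply_vacuumSubspace ?_
    rintro _ ⟨x, m, hm, rfl⟩
    show A (W x m) = (c • ContinuousLinearMap.id ℂ E) (W x m)
    rw [hAW, hcE m hm, map_smul, smul_apply, ContinuousLinearMap.id_apply]
  rw [hAc, smul_apply, ContinuousLinearMap.id_apply]

/-- **the unitary intertwiner of two jointly irreducible `(W, τ)` is unique up to `S¹`**: if `U₁, U₂ : E₁ ≃ₗᵢ[ℂ] E₂`
both intertwine the Weyl systems and the Heisenberg actions, then `U₂ = c • U₁` with `‖c‖ = 1` (Schur for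
`U₁⁻¹ U₂`); for the adelic `ρ_ψ` this is the kernel `ℂˣ` of the projection `(g, M_g) ↦ g` of the global group of pairs.
[cite: vonNeumann1931, §5] -/
theorem linearIsometryEquiv_unique_of_commuting_latticePair {E₂ : Type*} [NormedAddCommGroup E₂]
    [InnerProductSpace ℂ E₂] [Nontrivial E₁] (hW₁ : IsWeylSystem J W₁)
    (τ₁ : Representation ℂ (Heisenberg (polar β)) E₁)
    (h₁u : ∀ (h : Heisenberg (polar β)) (v : E₁), ‖τ₁ h v‖ = ‖v‖)
    (h₁W : ∀ (h : Heisenberg (polar β)) (x : V) (v : E₁), τ₁ h (W₁ x v) = W₁ x (τ₁ h v))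
    (h₁c : ∀ v : E₁, Continuous fun w : X × Y => τ₁ ⟨w, 0⟩ v)
    (h₁z : ∀ (t : R) (v : E₁), τ₁ (Heisenberg.ofCenter (polar β) (Multiplicative.ofAdd t)) v = ((ψ t : Circle) : ℂ) • v)
    (h₁i : ∀ K : Submodule ℂ E₁, IsClosed (K : Set E₁) → (∀ (x : V), ∀ v ∈ K, W₁ x v ∈ K) →
      (∀ (h : Heisenberg (polar β)), ∀ v ∈ K, τ₁ h v ∈ K) → K = ⊥ ∨ K = ⊤)
    (hB : IsDualLatticePair β ψ B₁ B₂)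
    (hX : ∀ N ∈ 𝓝 (0 : X), ∃ a : Rˣ, (((a : R) • B₁ : AddSubgroup X) : Set X) ⊆ N)
    (hY : ∀ N ∈ 𝓝 (0 : Y), ∃ a : Rˣ, (((a : R) • B₂ : AddSubgroup Y) : Set Y) ⊆ N)
    {W₂ : V → E₂ →L[ℂ] E₂} (τ₂ : Representation ℂ (Heisenberg (polar β)) E₂) (U₁ U₂ : E₁ ≃ₗᵢ[ℂ] E₂)
    (hU₁W : ∀ (x : V) (v : E₁), U₁ (W₁ x v) = W₂ x (U₁ v))
    (hU₁τ : ∀ (h : Heisenberg (polar β)) (v : E₁), U₁ (τ₁ h v) = τ₂ h (U₁ v))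
    (hU₂W : ∀ (x : V) (v : E₁), U₂ (W₁ x v) = W₂ x (U₂ v))
    (hU₂τ : ∀ (h : Heisenberg (polar β)) (v : E₁), U₂ (τ₁ h v) = τ₂ h (U₂ v)) :
    ∃ c : ℂ, ‖c‖ = 1 ∧ ∀ v : E₁, U₂ v = c • U₁ v := by
  set A : E₁ →L[ℂ] E₁ := ((U₂.trans U₁.symm).toContinuousLinearEquiv : E₁ →L[ℂ] E₁) with hAdef
  have hAv : ∀ v, A v = U₁.symm (U₂ v) := fun v => rfl
  have hAW : ∀ (x : V) (v : E₁), A (W₁ x v) = W₁ x (A v) := by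
    intro x v
    rw [hAv, hAv, hU₂W]
    apply U₁.injective
    rw [LinearIsometryEquiv.apply_symm_apply, hU₁W, LinearIsometryEquiv.apply_symm_apply]
  have hAτ : ∀ (h : Heisenberg (polar β)) (v : E₁), A (τ₁ h v) = τ₁ h (A v) := by
    intro h v
    rw [hAv, hAv, hU₂τ]
    apply U₁.injective
    rw [LinearIsometryEquiv.apply_symm_apply, hU₁τ, LinearIsometryEquiv.apply_symm_apply]
  obtain ⟨c, hc⟩ := exists_commutant_eq_smul_of_commuting_latticePair β ψ hW₁ τ₁ h₁u h₁W h₁c h₁z h₁i hB hX hY A hAW hAτ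
  have hU : ∀ v : E₁, U₂ v = c • U₁ v := fun v => by
    have h := hc v
    rw [hAv] at h
    have h2 := congrArg U₁ h
    rwa [LinearIsometryEquiv.apply_symm_apply, map_smul] at h2
  obtain ⟨v, hv⟩ := exists_ne (0 : E₁)
  refine ⟨c, ?_, hU⟩
  have h := congrArg (fun x => ‖x‖) (hU v)
  simp only [LinearIsometryEquiv.norm_map, norm_smul] at h
  have hv' : ‖v‖ ≠ 0 := norm_ne_zero_iff.2 hv
  field_simp at h
  linarith [h]

end Uniqueness

end IsWeylSystem

end Literature.RepresentationTheory.HeisenbergGroup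

end
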